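import Summits.QuantumFields.YangMills.Theorems.AlphaInputsT3ACv3HLiftBigClause
import Summits.QuantumFields.YangMills.Theorems.UnitScaleTiltHistoryTailOneSupplierWindowSplit
import HarnessLib

/-!
# `UnitScaleTiltHistoryTailOneSupplierDataRows` — **`HistoryTailL` ⇐ ⟨T8 text⟩ ∧ ⟨NODE O's (O″χ) χ data rows⟩, THE (FL) ROW DISCHARGED BY NAME**: the window-currency split
# `…OneSupplierWindowSplit` (this seat) with its (FL) hypothesis — the M22 big-k clause closed over records, families, couplings and runs — SUPPLIED by ★w4-19936 g3's
# `HLiftWindowKnit.bigClause_allL` ∕ `hBig_of_hLift_clause` (`hLift_clause` = `hLift_clause_of_PD` ∘ LEAD ★w1-19936 g2's `startT3_cert_omega`, over (H)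
# `exists_exact_lift_regional_window_kfree`, the kernel of record `obLift`, the START v3.1 system and ★w6-19936 g0's `Zfull_ge`): after this file the crux stmt-QuantumFields-19936
# BY NAME takes exactly TWO displayed deliverables, 19200's T8 text and NODE O's χ data rows in the UNCHANGED `hO` shape of `…OneSupplierSplit` — cell `ym3-torus`, route
# `UnitScaleTilt`, crux stmt-QuantumFields-19936 (v5p9, 2′χ) and item 19935 (2′), width seat `ym-ust-19936-w2` (g3)

WHY (★★OWNER ym3-torus-plan g25∕g26 (FL) programme, RULING g24-№4 «(FL)_non-ab ⇐ hLift ⇐ Newton[(LL)-regional ⊕ (V) ⊕ (B2) ⊕ k-uniform sup bounds]», W-SEAT MAP #3 M17–M22; ★w4-19936 g3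
06:00:59Z «CLOSING LINE → ★w2-19936 g3»).  DEPMAP v3.5's three arrows for 19936 were (T) ⇐ 19200, (FL) ⇐ `hLift`, (O″χ) ⇐ NODE O; with `bigClause_allL` in the tree the middle
arrow is a theorem, so the one-supplier display loses its (FL) hypothesis altogether.  THIS FILE is that specialisation, once, for the χ display (19936 ∕ 20520's 2′χ) and the
plain display (19935): `…WindowSplit`'s theorems at `B_big := 10²⁷`, `ε_FL := 1∕(10³⁴·L)` with `hBig := hBig_of_hLift_clause` (per `L`, after `subst hF`) ∕ `bigClause_allL`
(all `L`).  The kinematic floor `max (10²⁷+1) 257 · L²` and the window floor `10³⁴·L·avgWindowFactor L ∕ 24` are absorbed into the served floor inside `…WindowSplit`.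
WHAT (def-free).  §1 ★★ `pinnedPartsT3ACRecFLChi_of_thm1_dataRows` (χ display from (T) at any constants + `hO`), `alphaInputsT3ACv3RecChi_of_thm1_dataRows` (registered 2′χ
text); §2 ★★★ `historyTailL_of_thm1In8_dataRows_allL (hT8) (hO) : HistoryTailL` — stmt-QuantumFields-19936 BY NAME from ⟨T8⟩ ∧ ⟨∀ odd L > 1, NODE O's `hO`⟩; §3 the
plain twins for item 19935 (`pinnedPartsT3ACRecFL_of_thm1_dataRows`, `alphaInputsT3ACv3Rec_of_thm1_dataRows`).
HONEST FRAMING.  Composition of landed theorems; the two remaining hypotheses — T8 (19200's line: `Thm1GlobalMinAt ∧ MinimisersIn8At` at every odd `L`) and NODE O's (O″χ) ∕ (O″)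
data rows for its own records — are analytic content NOT proved here, so the stub `stub_laneRecordsV3Chi`, the crux `HistoryTailL` and item 19935 are NOT closed by this file;
count-neutral helper (`--supports stmt-QuantumFields-19936`); registry untouched.  YM₃ on the three-torus is rung R3 of the programme, NOT the Clay problem: nothing here
bears on d = 4, infinite volume, or a mass gap.

References: T. Bałaban, Commun. Math. Phys. 102 (1985) 277–309 [Balaban1985Variational] (Thm 1 (6)–(8) pp.278–279, (11)–(15) pp.279–280, Prop 8 p.304); Commun. Math. Phys.
102 (1985) 255–275 [Balaban1985UV3] ((5) p.256, (7) p.257, (38)–(42) p.266, (45)+(47) p.267, (68)+(71) p.273, Thm 2 p.272); Commun. Math. Phys. 98 (1985) 17–51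
[Balaban1985Averaging] (Props. 4–5 pp.38–42); C. King, Commun. Math. Phys. 102 (1986) 649–677 [King1986] ((3.12) p.657).
-/

set_option autoImplicit false

noncomputable section

namespace Summit.QuantumFields.YangMills.Theorems.HistoryTailOneSupplier

open MeasureTheory Set
open scoped Matrix.Norms.L2Operator
open Literature.MathematicalPhysics.QuantumFieldTheory.Balaban1983to89
open Literature.MathematicalPhysics.QuantumFieldTheory.Balaban1983to89.T3ContinuumYM3Torus
open Literature.MathematicalPhysics.QuantumFieldTheory.Balaban1983to89.T3UnitLawDensityEML (ℰp)
open Literature.MathematicalPhysics.QuantumFieldTheory.Balaban1983to89.T3UnitScaleTilt (θBal)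
open Literature.MathematicalPhysics.QuantumFieldTheory.Balaban1983to89.T3PrintedMinimiserExistence (Thm1GlobalMinAt)
open Literature.MathematicalPhysics.QuantumFieldTheory.Balaban1983to89.T3LowerAlongMinimisersSplit (MinimisersIn8At)
open Literature.MathematicalPhysics.QuantumFieldTheory.Balaban1983to89.ExpMeanLog (deltaSU deltaSU_pos)
open Literature.MathematicalPhysics.QuantumFieldTheory.Balaban1983to89.B10Eq38TorusDomains (plaqsIn)
open Literature.MathematicalPhysics.QuantumFieldTheory.Balaban1983to89.B10Eq42TorusConstraint (bondsIn)
open Literature.MathematicalPhysics.QuantumFieldTheory.Balaban1985CMP102.Setting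
open Summit.QuantumFields.Balaban3D.Carriers
open Summit.QuantumFields.Balaban3D.Proofs.Primitives
open Summit.QuantumFields.Balaban3D.Proofs.Thresholds (Q0 Q0_pos)
open Summit.QuantumFields.YangMills.Theorems.HLiftWindowKnit (hBig_of_hLift_clause bigClause_allL)
open B7Prop2Explicit (C0 C0_pos)

/-! ## §1 The χ display and the 2′χ text from (T) and NODE O's rows — (FL) discharged -/

/-- ★★ **THE 2′χ DISPLAY FROM (T) AT ANY CONSTANTS AND THE (O″χ) ROWS ALONE — THE (FL) ROW IS A THEOREM.**  `hT`: [Balaban1985Variational] Thm 1 (global reading) at SOME constants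
(19200's crux); `hO`: VERBATIM the (O″χ) rows of `…OneSupplierSplit.pinnedPartsT3ACRecFLChi_of_thm1_fineLifts_dataRows` (NODE O exhibits, for every `(B, a₀, a₁)` above its floor,
a record with exact profile and its χ data rows).  Then `PinnedPartsT3ACRecFLChi L` — `pinnedPartsT3ACRecFLChi_of_thm1_bigClause_dataRows` at `B_big := 10²⁷`,
`ε_FL := 1∕(10³⁴·L)`, its `hBig` by ★w4's `hBig_of_hLift_clause` after `subst hF`. [cite: Balaban1985Variational, Thm 1 (6)–(8) pp.278–279, (11)–(15) pp.279–280; Balaban1985UV3, (7) p.257, (38)–(42) p.266, (45)+(47) p.267, (68) p.273 and Thm 2 p.272] -/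
theorem pinnedPartsT3ACRecFLChi_of_thm1_dataRows {L : ℕ} (hL : 1 < L)
    (hT : ∃ a₀ a₁ B₃ : ℝ, 0 < a₀ ∧ 0 < a₁ ∧ 0 < B₃ ∧ Thm1GlobalMinAt L a₀ a₁ B₃)
    {B₀ A₀ A₁ : ℝ} (hA₀ : 0 < A₀) (hA₁ : 0 < A₁)
    (hO : ∀ (B a₀ a₁ : ℝ), B₀ ≤ B → 1 ≤ 2 * B → 0 < a₀ → a₀ ≤ A₀ → 0 < a₁ → a₁ ≤ A₁ → B * a₁ ≤ a₀ →
        (143 * ((((3 + 4 : ℕ) : ℝ)) ^ 2 / 4) ^ 2) * (2 * (B * a₁)) ≤ 1 / 3 →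
        2 * (2 * (B * a₁)) ≤ 2 * deltaSU (Fin 2) / (((3 + 4) * L : ℕ) : ℝ) ^ 2 →
        Thm1GlobalMinAt L a₀ a₁ B →
        ∃ (b₁ p₁ : ℝ), ∀ (b₀ p₀ : ℝ), b₁ ≤ b₀ → p₁ ≤ p₀ →
          ∃ 𝔠 : AlphaConsts L (suGroupModel 2).N, 𝔠.b₀ = b₀ ∧ 𝔠.p₀ = p₀ ∧ 𝔠.B₃ = B ∧
            4 * 𝔠.B₃ * (L : ℝ) ^ 2 * avgWindowFactor L ≤ 𝔠.C68 ∧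
            Real.exp (𝔠.p₀ - 1) ≤ 3 * C0 3 * 𝔠.C68 * (𝔠.b₀ * Q0 𝔠.p₀) ∧
            (𝔠.b₀ * Q0 𝔠.p₀) * (2 * (L : ℝ) ^ 2 * avgWindowFactor L) ^ 2 ≤ 3 * C0 3 * 𝔠.C68 * a₁ ^ 2 ∧
            7 * L + 3 ≤ 𝔠.M₁ ∧
            ∀ (F : T3Family) (hF : F.L = L),
              (∀ (γ : ℝ) (hγ : 0 < γ) (hγ1 : γ ≤ (min (hF ▸ 𝔠).gamma0 1) ^ 2) (K : ℕ),
                (∃ Ut : (k : ℕ) → GaugeField (F.P K) k (Matrix.specialUnitaryGroup (Fin 2) ℂ) →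
                    GaugeField (F.P K) 0 (Matrix.specialUnitaryGroup (Fin 2) ℂ),
                  AlphaInputsT3AC.TrivMinimiserRowsT3 F (hF ▸ 𝔠) γ hγ hγ1 a₀ a₁ K Ut) →
                ∃ Ut : (k : ℕ) → GaugeField (F.P K) k (Matrix.specialUnitaryGroup (Fin 2) ℂ) →
                    GaugeField (F.P K) 0 (Matrix.specialUnitaryGroup (Fin 2) ℂ),
                  AlphaInputsT3AC.TrivMinimiserRowsT3 F (hF ▸ 𝔠) γ hγ hγ1 a₀ a₁ K Ut ∧
                    AlphaInputsT3AC.DataRowsT3XChi F (hF ▸ 𝔠) γ hγ hγ1 K Ut)) :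
    AlphaInputsT3AC.PinnedPartsT3ACRecFLChi L := by
  have hLpos : (0 : ℝ) < (L : ℝ) := by exact_mod_cast (zero_lt_one.trans hL)
  refine pinnedPartsT3ACRecFLChi_of_thm1_bigClause_dataRows hL hT (Bbig := (10 : ℝ) ^ 27) (εFL := 1 / (10 ^ 34 * (L : ℝ)))
    (by positivity) (fun F hF 𝔠 γ hγ hγ1 K => ?_) hA₀ hA₁ hO
  subst hF
  exact hBig_of_hLift_clause F 𝔠 γ hγ hγ1 K

/-- ★★ **THE REGISTERED 2′χ TEXT `AlphaInputsT3ACv3RecChi L` FROM (T) AND THE (O″χ) ROWS ALONE** (§1 through w2 g0's `alphaInputsT3ACv3RecChi_of_pinnedPartsRecFLChi`); serves 20520's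
v5kC 2′χ identically. [cite: Balaban1985UV3, Thm 2 p.272 and (47) p.267; Balaban1985Variational, Thm 1 (8) p.279] -/
theorem alphaInputsT3ACv3RecChi_of_thm1_dataRows {L : ℕ} (hL : 1 < L)
    (hT : ∃ a₀ a₁ B₃ : ℝ, 0 < a₀ ∧ 0 < a₁ ∧ 0 < B₃ ∧ Thm1GlobalMinAt L a₀ a₁ B₃)
    {B₀ A₀ A₁ : ℝ} (hA₀ : 0 < A₀) (hA₁ : 0 < A₁)
    (hO : ∀ (B a₀ a₁ : ℝ), B₀ ≤ B → 1 ≤ 2 * B → 0 < a₀ → a₀ ≤ A₀ → 0 < a₁ → a₁ ≤ A₁ → B * a₁ ≤ a₀ →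
        (143 * ((((3 + 4 : ℕ) : ℝ)) ^ 2 / 4) ^ 2) * (2 * (B * a₁)) ≤ 1 / 3 →
        2 * (2 * (B * a₁)) ≤ 2 * deltaSU (Fin 2) / (((3 + 4) * L : ℕ) : ℝ) ^ 2 →
        Thm1GlobalMinAt L a₀ a₁ B →
        ∃ (b₁ p₁ : ℝ), ∀ (b₀ p₀ : ℝ), b₁ ≤ b₀ → p₁ ≤ p₀ →
          ∃ 𝔠 : AlphaConsts L (suGroupModel 2).N, 𝔠.b₀ = b₀ ∧ 𝔠.p₀ = p₀ ∧ 𝔠.B₃ = B ∧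
            4 * 𝔠.B₃ * (L : ℝ) ^ 2 * avgWindowFactor L ≤ 𝔠.C68 ∧
            Real.exp (𝔠.p₀ - 1) ≤ 3 * C0 3 * 𝔠.C68 * (𝔠.b₀ * Q0 𝔠.p₀) ∧
            (𝔠.b₀ * Q0 𝔠.p₀) * (2 * (L : ℝ) ^ 2 * avgWindowFactor L) ^ 2 ≤ 3 * C0 3 * 𝔠.C68 * a₁ ^ 2 ∧
            7 * L + 3 ≤ 𝔠.M₁ ∧
            ∀ (F : T3Family) (hF : F.L = L),
              (∀ (γ : ℝ) (hγ : 0 < γ) (hγ1 : γ ≤ (min (hF ▸ 𝔠).gamma0 1) ^ 2) (K : ℕ),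
                (∃ Ut : (k : ℕ) → GaugeField (F.P K) k (Matrix.specialUnitaryGroup (Fin 2) ℂ) →
                    GaugeField (F.P K) 0 (Matrix.specialUnitaryGroup (Fin 2) ℂ),
                  AlphaInputsT3AC.TrivMinimiserRowsT3 F (hF ▸ 𝔠) γ hγ hγ1 a₀ a₁ K Ut) →
                ∃ Ut : (k : ℕ) → GaugeField (F.P K) k (Matrix.specialUnitaryGroup (Fin 2) ℂ) →
                    GaugeField (F.P K) 0 (Matrix.specialUnitaryGroup (Fin 2) ℂ),
                  AlphaInputsT3AC.TrivMinimiserRowsT3 F (hF ▸ 𝔠) γ hγ hγ1 a₀ a₁ K Ut ∧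
                    AlphaInputsT3AC.DataRowsT3XChi F (hF ▸ 𝔠) γ hγ hγ1 K Ut)) :
    AlphaInputsT3ACv3RecChi L :=
  alphaInputsT3ACv3RecChi_of_pinnedPartsRecFLChi (pinnedPartsT3ACRecFLChi_of_thm1_dataRows hL hT hA₀ hA₁ hO)

/-! ## §2 The crux from T8's text and NODE O's rows — (FL) discharged -/

/-- ★★★ **`HistoryTailL` ⇐ ⟨v5kC's T8 TEXT⟩ ∧ (∀ odd `L > 1`, THE (O″χ) ROWS)** — stmt-QuantumFields-19936 by name from TWO independently owned deliverables: 19200's line (T8: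
`Thm1GlobalMinAt ∧ MinimisersIn8At` at every odd `L > 1`) and NODE O's χ data rows for its own records, VERBATIM the `hO` of `…OneSupplierSplit.historyTailL_of_thm1In8_fineLifts_dataRows_allL`;
the (FL) row is ★w4's `bigClause_allL`. [cite: Balaban1985UV3, (5) p.256, (45)+(47) p.267, (71) p.273 and Thm 2 p.272; Balaban1985Variational, Thm 1 (8) p.279, (11)–(15) pp.279–280 and Prop 8 p.304; King1986, (3.12) p.657] -/
theorem historyTailL_of_thm1In8_dataRows_allL
    (hT8 : ∀ L : ℕ, Odd L → 1 < L → ∃ a₀ a₁ B₃ : ℝ, 0 < a₀ ∧ 0 < a₁ ∧ 0 < B₃ ∧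
      Thm1GlobalMinAt L a₀ a₁ B₃ ∧ MinimisersIn8At L a₀ a₁ B₃)
    (hO : ∀ L : ℕ, Odd L → 1 < L → ∃ (B₀ A₀ A₁ : ℝ), 0 < A₀ ∧ 0 < A₁ ∧
      ∀ (B a₀ a₁ : ℝ), B₀ ≤ B → 1 ≤ 2 * B → 0 < a₀ → a₀ ≤ A₀ → 0 < a₁ → a₁ ≤ A₁ → B * a₁ ≤ a₀ →
        (143 * ((((3 + 4 : ℕ) : ℝ)) ^ 2 / 4) ^ 2) * (2 * (B * a₁)) ≤ 1 / 3 →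
        2 * (2 * (B * a₁)) ≤ 2 * deltaSU (Fin 2) / (((3 + 4) * L : ℕ) : ℝ) ^ 2 →
        Thm1GlobalMinAt L a₀ a₁ B →
        ∃ (b₁ p₁ : ℝ), ∀ (b₀ p₀ : ℝ), b₁ ≤ b₀ → p₁ ≤ p₀ →
          ∃ 𝔠 : AlphaConsts L (suGroupModel 2).N, 𝔠.b₀ = b₀ ∧ 𝔠.p₀ = p₀ ∧ 𝔠.B₃ = B ∧
            4 * 𝔠.B₃ * (L : ℝ) ^ 2 * avgWindowFactor L ≤ 𝔠.C68 ∧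
            Real.exp (𝔠.p₀ - 1) ≤ 3 * C0 3 * 𝔠.C68 * (𝔠.b₀ * Q0 𝔠.p₀) ∧
            (𝔠.b₀ * Q0 𝔠.p₀) * (2 * (L : ℝ) ^ 2 * avgWindowFactor L) ^ 2 ≤ 3 * C0 3 * 𝔠.C68 * a₁ ^ 2 ∧
            7 * L + 3 ≤ 𝔠.M₁ ∧
            ∀ (F : T3Family) (hF : F.L = L),
              (∀ (γ : ℝ) (hγ : 0 < γ) (hγ1 : γ ≤ (min (hF ▸ 𝔠).gamma0 1) ^ 2) (K : ℕ),
                (∃ Ut : (k : ℕ) → GaugeField (F.P K) k (Matrix.specialUnitaryGroup (Fin 2) ℂ) →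
                    GaugeField (F.P K) 0 (Matrix.specialUnitaryGroup (Fin 2) ℂ),
                  AlphaInputsT3AC.TrivMinimiserRowsT3 F (hF ▸ 𝔠) γ hγ hγ1 a₀ a₁ K Ut) →
                ∃ Ut : (k : ℕ) → GaugeField (F.P K) k (Matrix.specialUnitaryGroup (Fin 2) ℂ) →
                    GaugeField (F.P K) 0 (Matrix.specialUnitaryGroup (Fin 2) ℂ),
                  AlphaInputsT3AC.TrivMinimiserRowsT3 F (hF ▸ 𝔠) γ hγ hγ1 a₀ a₁ K Ut ∧
                    AlphaInputsT3AC.DataRowsT3XChi F (hF ▸ 𝔠) γ hγ hγ1 K Ut)) :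
    Summit.QuantumFields.YangMills.Theses.UnitScaleTilt.HistoryTailL :=
  historyTailL_of_thm1In8_bigClause_dataRows_allL hT8 bigClause_allL hO

/-! ## §3 The plain display and the 2′ text of item 19935 from (T) and NODE O's plain rows — (FL) discharged -/

/-- ★★ **THE 2′ DISPLAY OF RECORD (item 19935, plain data rows) FROM (T) AT ANY CONSTANTS AND THE (O″) ROWS ALONE** (`pinnedPartsT3ACRecFL_of_thm1_bigClause_dataRows` with `hBig` by
`hBig_of_hLift_clause`). [cite: Balaban1985Variational, Thm 1 (6)–(8) pp.278–279, (11)–(15) pp.279–280; Balaban1985UV3, (7) p.257, (38)–(42) p.266, (45) p.267, (68) p.273, Thm 2 p.272] -/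
theorem pinnedPartsT3ACRecFL_of_thm1_dataRows {L : ℕ} (hL : 1 < L)
    (hT : ∃ a₀ a₁ B₃ : ℝ, 0 < a₀ ∧ 0 < a₁ ∧ 0 < B₃ ∧ Thm1GlobalMinAt L a₀ a₁ B₃)
    {B₀ A₀ A₁ : ℝ} (hA₀ : 0 < A₀) (hA₁ : 0 < A₁)
    (hO : ∀ (B a₀ a₁ : ℝ), B₀ ≤ B → 1 ≤ 2 * B → 0 < a₀ → a₀ ≤ A₀ → 0 < a₁ → a₁ ≤ A₁ → B * a₁ ≤ a₀ →
        (143 * ((((3 + 4 : ℕ) : ℝ)) ^ 2 / 4) ^ 2) * (2 * (B * a₁)) ≤ 1 / 3 →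
        2 * (2 * (B * a₁)) ≤ 2 * deltaSU (Fin 2) / (((3 + 4) * L : ℕ) : ℝ) ^ 2 →
        Thm1GlobalMinAt L a₀ a₁ B →
        ∃ (b₁ p₁ : ℝ), ∀ (b₀ p₀ : ℝ), b₁ ≤ b₀ → p₁ ≤ p₀ →
          ∃ 𝔠 : AlphaConsts L (suGroupModel 2).N, 𝔠.b₀ = b₀ ∧ 𝔠.p₀ = p₀ ∧ 𝔠.B₃ = B ∧
            4 * 𝔠.B₃ * (L : ℝ) ^ 2 * avgWindowFactor L ≤ 𝔠.C68 ∧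
            Real.exp (𝔠.p₀ - 1) ≤ 3 * C0 3 * 𝔠.C68 * (𝔠.b₀ * Q0 𝔠.p₀) ∧
            (𝔠.b₀ * Q0 𝔠.p₀) * (2 * (L : ℝ) ^ 2 * avgWindowFactor L) ^ 2 ≤ 3 * C0 3 * 𝔠.C68 * a₁ ^ 2 ∧
            7 * L + 3 ≤ 𝔠.M₁ ∧
            ∀ (F : T3Family) (hF : F.L = L),
              (∀ (γ : ℝ) (hγ : 0 < γ) (hγ1 : γ ≤ (min (hF ▸ 𝔠).gamma0 1) ^ 2) (K : ℕ),
                (∃ Ut : (k : ℕ) → GaugeField (F.P K) k (Matrix.specialUnitaryGroup (Fin 2) ℂ) →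
                    GaugeField (F.P K) 0 (Matrix.specialUnitaryGroup (Fin 2) ℂ),
                  AlphaInputsT3AC.TrivMinimiserRowsT3 F (hF ▸ 𝔠) γ hγ hγ1 a₀ a₁ K Ut) →
                ∃ Ut : (k : ℕ) → GaugeField (F.P K) k (Matrix.specialUnitaryGroup (Fin 2) ℂ) →
                    GaugeField (F.P K) 0 (Matrix.specialUnitaryGroup (Fin 2) ℂ),
                  AlphaInputsT3AC.TrivMinimiserRowsT3 F (hF ▸ 𝔠) γ hγ hγ1 a₀ a₁ K Ut ∧
                    AlphaInputsT3AC.DataRowsT3X F (hF ▸ 𝔠) γ hγ hγ1 K Ut)) :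
    AlphaInputsT3AC.PinnedPartsT3ACRecFL L := by
  have hLpos : (0 : ℝ) < (L : ℝ) := by exact_mod_cast (zero_lt_one.trans hL)
  refine pinnedPartsT3ACRecFL_of_thm1_bigClause_dataRows hL hT (Bbig := (10 : ℝ) ^ 27) (εFL := 1 / (10 ^ 34 * (L : ℝ)))
    (by positivity) (fun F hF 𝔠 γ hγ hγ1 K => ?_) hA₀ hA₁ hO
  subst hF
  exact hBig_of_hLift_clause F 𝔠 γ hγ hγ1 K

/-- ★★ **THE REGISTERED 2′ TEXT `AlphaInputsT3ACv3Rec L` (item 19935) FROM (T) AND THE (O″) ROWS ALONE** (the plain display through `alphaInputsT3ACv3Rec_of_pinnedPartsRecFL`).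
[cite: Balaban1985UV3, Thm 2 p.272; Balaban1985Variational, Thm 1 (8) p.279] -/
theorem alphaInputsT3ACv3Rec_of_thm1_dataRows {L : ℕ} (hL : 1 < L)
    (hT : ∃ a₀ a₁ B₃ : ℝ, 0 < a₀ ∧ 0 < a₁ ∧ 0 < B₃ ∧ Thm1GlobalMinAt L a₀ a₁ B₃)
    {B₀ A₀ A₁ : ℝ} (hA₀ : 0 < A₀) (hA₁ : 0 < A₁)
    (hO : ∀ (B a₀ a₁ : ℝ), B₀ ≤ B → 1 ≤ 2 * B → 0 < a₀ → a₀ ≤ A₀ → 0 < a₁ → a₁ ≤ A₁ → B * a₁ ≤ a₀ →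
        (143 * ((((3 + 4 : ℕ) : ℝ)) ^ 2 / 4) ^ 2) * (2 * (B * a₁)) ≤ 1 / 3 →
        2 * (2 * (B * a₁)) ≤ 2 * deltaSU (Fin 2) / (((3 + 4) * L : ℕ) : ℝ) ^ 2 →
        Thm1GlobalMinAt L a₀ a₁ B →
        ∃ (b₁ p₁ : ℝ), ∀ (b₀ p₀ : ℝ), b₁ ≤ b₀ → p₁ ≤ p₀ →
          ∃ 𝔠 : AlphaConsts L (suGroupModel 2).N, 𝔠.b₀ = b₀ ∧ 𝔠.p₀ = p₀ ∧ 𝔠.B₃ = B ∧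
            4 * 𝔠.B₃ * (L : ℝ) ^ 2 * avgWindowFactor L ≤ 𝔠.C68 ∧
            Real.exp (𝔠.p₀ - 1) ≤ 3 * C0 3 * 𝔠.C68 * (𝔠.b₀ * Q0 𝔠.p₀) ∧
            (𝔠.b₀ * Q0 𝔠.p₀) * (2 * (L : ℝ) ^ 2 * avgWindowFactor L) ^ 2 ≤ 3 * C0 3 * 𝔠.C68 * a₁ ^ 2 ∧
            7 * L + 3 ≤ 𝔠.M₁ ∧
            ∀ (F : T3Family) (hF : F.L = L),
              (∀ (γ : ℝ) (hγ : 0 < γ) (hγ1 : γ ≤ (min (hF ▸ 𝔠).gamma0 1) ^ 2) (K : ℕ),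
                (∃ Ut : (k : ℕ) → GaugeField (F.P K) k (Matrix.specialUnitaryGroup (Fin 2) ℂ) →
                    GaugeField (F.P K) 0 (Matrix.specialUnitaryGroup (Fin 2) ℂ),
                  AlphaInputsT3AC.TrivMinimiserRowsT3 F (hF ▸ 𝔠) γ hγ hγ1 a₀ a₁ K Ut) →
                ∃ Ut : (k : ℕ) → GaugeField (F.P K) k (Matrix.specialUnitaryGroup (Fin 2) ℂ) →
                    GaugeField (F.P K) 0 (Matrix.specialUnitaryGroup (Fin 2) ℂ),
                  AlphaInputsT3AC.TrivMinimiserRowsT3 F (hF ▸ 𝔠) γ hγ hγ1 a₀ a₁ K Ut ∧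
                    AlphaInputsT3AC.DataRowsT3X F (hF ▸ 𝔠) γ hγ hγ1 K Ut)) :
    AlphaInputsT3ACv3Rec L :=
  alphaInputsT3ACv3Rec_of_pinnedPartsRecFL (pinnedPartsT3ACRecFL_of_thm1_dataRows hL hT hA₀ hA₁ hO)

end Summit.QuantumFields.YangMills.Theorems.HistoryTailOneSupplier

end
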